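import Summits.Ventures.QEC.Basic.HypergraphProductSector
import Literature.InformationTheory.QuantumCodes.HypergraphProductSectorExact

/-!
# `HGP(H₁, H₂)`: the two sector distances `d_X`, `d_Z` and the minimum distance in CLOSED FORM (venture-side instance)

LADDER-QEC (venture cell `qec`, PARTITION item 04.HGPK2), `Summits/Ventures/QEC/Basic/`. Companion to
`Basic/HypergraphProductSector.lean` (qec-type-04). The Literature file
`Literature/InformationTheory/QuantumCodes/HypergraphProductSectorExact.lean` proves Zeng–Pryadko's Theorem 17
([ZengPryadko2020], length-two case, both halves) for Tillich–Zémor's `Q_{ℋ₁·ℋ₂}`; under the dictionary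
`HGP(H₁,H₂) = Q_{ℋ₁·ℋ₂ᵀ}` of `Basic/HypergraphProduct.lean` (`HGP.HX H₁ H₂ = xMatrix H₁ H₂ᵀ`, `HGP.HZ H₁ H₂ = zMatrix H₁ H₂ᵀ`)
it reads, with `dᵢ = d(ker Hᵢ)`, `dᵢᵀ = d(ker Hᵢᵀ)` (`⊤` for a zero code), `kᵢ = dim ker Hᵢ`, `kᵢᵀ = dim ker Hᵢᵀ`:

* `HGP.dZ_eq` — `d_Z(HGP(H₁,H₂)) = min( d₁·[k₂ ≥ 1], d₂ᵀ·[k₁ᵀ ≥ 1] )`;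
* `HGP.dX_eq` — `d_X(HGP(H₁,H₂)) = min( d₁ᵀ·[k₂ᵀ ≥ 1], d₂·[k₁ ≥ 1] )`;
* `HGP.distance_eq` — `D(HGP(H₁,H₂)) = min(d_X, d_Z)` with both substituted: the minimum distance of EVERY hypergraph
  product of two binary matrices, no hypothesis (contains `distance_ge`, `distance_le_min`, `distance_eq_min_*`);
* `HGP.pcCode_ne_bot_iff_rank_lt`, `HGP.pcCode_transpose_ne_bot_iff_rank_lt` — the guards as rank conditions
  (`[k ≥ 1] ⟺ rank H < n`, `[kᵀ ≥ 1] ⟺ rank H < m`), so that a census file discharges them from a rank certificate.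

The guard `[P]` is written `⨅ (_ : P), d` (`= d` if `P`, `= ⊤` otherwise). HONEST FRAMING: theorems about all pairs of
binary matrices; they certify no specific code. Use: a census row's `X`- and `Z`-distances separately at tier KERNEL
from the classical seed certificates already in `Census/HGP/Seeds*.lean` (the `IsCode` rows give only `D`).

References: [ZengPryadko2020] Zeng–Pryadko, Phys. Rev. A 102, 062402 (2020) = arXiv:2007.12152, Thm 17 (chunk p0018
L1-12), Statement 14 (chunk p0016 L23-72); [TillichZemor2014] Tillich–Zémor, IEEE Trans. IT 60 (2014) 1193 =
arXiv:0903.0566v1, Thm 9, Lemma 10 (chunk p0008).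
-/

namespace Summit.Ventures.QEC.HGP

open Matrix Module
open Literature.InformationTheory.QuantumCodes
open Literature.InformationTheory.Coding (minDist)

variable {m₁ n₁ m₂ n₂ : ℕ}

/-! ### The guards as rank conditions -/

/-- `ker H ≠ 0 ↔ rank H < n` for an `m × n` binary matrix (rank–nullity): the Künneth guard `[k ≥ 1]` from a rank
certificate. [cite: TillichZemor2014, §5 eq. (1) (arXiv v1 chunk p0008 L5-8: `dim Z(ℋ) = |E| − dim Z(ℋ)^⊥`)] -/
theorem pcCode_ne_bot_iff_rank_lt {m n : ℕ} (H : Matrix (Fin m) (Fin n) (ZMod 2)) : pcCode H ≠ ⊥ ↔ H.rank < n := by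
  have h := rank_add_finrank_pcCode H
  rw [Fintype.card_fin] at h
  rw [Ne, ← Submodule.finrank_eq_zero]
  omega

/-- `ker Hᵀ ≠ 0 ↔ rank H < m` for an `m × n` binary matrix: the Künneth guard `[kᵀ ≥ 1]` from a rank certificate.
[cite: TillichZemor2014, §6 (arXiv v1 chunk p0009 L8-10: full rank means `dim Z(ℋᵀ) = 0`)] -/
theorem pcCode_transpose_ne_bot_iff_rank_lt {m n : ℕ} (H : Matrix (Fin m) (Fin n) (ZMod 2)) :
    pcCode Hᵀ ≠ ⊥ ↔ H.rank < m := by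
  rw [pcCode_ne_bot_iff_rank_lt, Matrix.rank_transpose]

/-! ### The sector distances and the minimum distance of `HGP(H₁, H₂)` in closed form -/

/-- **`d_Z(HGP(H₁,H₂)) = min( d₁·[k₂ ≥ 1], d₂ᵀ·[k₁ᵀ ≥ 1] )`** (`Z`-type logicals: the Künneth classes
`ker H₁ ⊗ coker H₂ᵀ` of weight `≥ d₁`, present iff `k₂ ≥ 1`, and `coker H₁ ⊗ ker H₂ᵀ` of weight `≥ d₂ᵀ`, present iff
`k₁ᵀ ≥ 1`; each attained). Zeng–Pryadko Thm 17 for `Q_{ℋ₁·ℋ₂ᵀ}`.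
[cite: ZengPryadko2020, Thm 17 (chunk p0018 L1-12) and Statement 14 (chunk p0016 L23-72)] -/
theorem dZ_eq (H₁ : Matrix (Fin m₁) (Fin n₁) (ZMod 2)) (H₂ : Matrix (Fin m₂) (Fin n₂) (ZMod 2)) :
    cssDistZ (HX H₁ H₂) (HZ H₁ H₂) =
      min (⨅ (_ : pcCode H₂ ≠ ⊥), minDist (pcCode H₁)) (⨅ (_ : pcCode H₁ᵀ ≠ ⊥), minDist (pcCode H₂ᵀ)) := by
  have h := HypergraphProduct.cssDistZ_xMatrix_eq H₁ H₂ᵀ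
  rw [Matrix.transpose_transpose] at h
  exact h

/-- **`d_X(HGP(H₁,H₂)) = min( d₁ᵀ·[k₂ᵀ ≥ 1], d₂·[k₁ ≥ 1] )`** (`X`-type logicals: the classes `ker H₁ᵀ ⊗ coker H₂`
and `coker H₁ᵀ ⊗ ker H₂`). Zeng–Pryadko Thm 17 for the co-chain complex of `Q_{ℋ₁·ℋ₂ᵀ}`.
[cite: ZengPryadko2020, Thm 17 (chunk p0018 L1-12) and Statement 14 (chunk p0016 L23-72)] -/
theorem dX_eq (H₁ : Matrix (Fin m₁) (Fin n₁) (ZMod 2)) (H₂ : Matrix (Fin m₂) (Fin n₂) (ZMod 2)) :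
    cssDistX (HX H₁ H₂) (HZ H₁ H₂) =
      min (⨅ (_ : pcCode H₂ᵀ ≠ ⊥), minDist (pcCode H₁ᵀ)) (⨅ (_ : pcCode H₁ ≠ ⊥), minDist (pcCode H₂)) := by
  have h := HypergraphProduct.cssDistX_xMatrix_eq H₁ H₂ᵀ
  rw [Matrix.transpose_transpose] at h
  exact h

/-- **The minimum distance of every hypergraph product, closed form:** `D(HGP(H₁,H₂)) = min(d_X, d_Z)` with
`d_X = min(d₁ᵀ·[k₂ᵀ ≥ 1], d₂·[k₁ ≥ 1])`, `d_Z = min(d₁·[k₂ ≥ 1], d₂ᵀ·[k₁ᵀ ≥ 1])` — no hypothesis on the seeds. Dropping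
the guards gives Tillich–Zémor's `D ≥ min(d₁, d₂, d₁ᵀ, d₂ᵀ)` (`HGP.distance_ge`); the regimes of
`Basic/HypergraphProductCensus.lean` / `Basic/HypergraphProductSector.lean` are its special cases.
[cite: ZengPryadko2020, Thm 17 (chunk p0018 L1-12)] [cite: TillichZemor2014, Thm 9 and Lemma 10 (arXiv v1 chunk p0008 L11-15, L53-62)] -/
theorem distance_eq (H₁ : Matrix (Fin m₁) (Fin n₁) (ZMod 2)) (H₂ : Matrix (Fin m₂) (Fin n₂) (ZMod 2)) :
    cssMinDist (HX H₁ H₂) (HZ H₁ H₂) =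
      min (min (⨅ (_ : pcCode H₂ᵀ ≠ ⊥), minDist (pcCode H₁ᵀ)) (⨅ (_ : pcCode H₁ ≠ ⊥), minDist (pcCode H₂)))
          (min (⨅ (_ : pcCode H₂ ≠ ⊥), minDist (pcCode H₁)) (⨅ (_ : pcCode H₁ᵀ ≠ ⊥), minDist (pcCode H₂ᵀ))) := by
  rw [cssMinDist_eq_min_cssDistX_cssDistZ, dX_eq, dZ_eq]

/-! ### Census form: both guards of a sector from rank certificates -/

/-- **`Z`-distance from classical certificates** when both `Z`-classes are present (`rank H₂ < n₂`, `rank H₁ < m₁`):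
`d_Z(HGP(H₁,H₂)) = min(d₁, d₂ᵀ)` as an `ℕ∞` identity in the two classical distances (themselves `⊤` for zero codes).
[cite: ZengPryadko2020, Thm 17 (chunk p0018 L1-12)] -/
theorem dZ_eq_of_rank_lt (H₁ : Matrix (Fin m₁) (Fin n₁) (ZMod 2)) (H₂ : Matrix (Fin m₂) (Fin n₂) (ZMod 2))
    (h₂ : H₂.rank < n₂) (h₁ : H₁.rank < m₁) :
    cssDistZ (HX H₁ H₂) (HZ H₁ H₂) = min (minDist (pcCode H₁)) (minDist (pcCode H₂ᵀ)) := by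
  rw [dZ_eq, iInf_pos ((pcCode_ne_bot_iff_rank_lt H₂).2 h₂), iInf_pos ((pcCode_transpose_ne_bot_iff_rank_lt H₁).2 h₁)]

/-- **`X`-distance from classical certificates** when both `X`-classes are present (`rank H₂ < m₂`, `rank H₁ < n₁`):
`d_X(HGP(H₁,H₂)) = min(d₁ᵀ, d₂)`. [cite: ZengPryadko2020, Thm 17 (chunk p0018 L1-12)] -/
theorem dX_eq_of_rank_lt (H₁ : Matrix (Fin m₁) (Fin n₁) (ZMod 2)) (H₂ : Matrix (Fin m₂) (Fin n₂) (ZMod 2))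
    (h₂ : H₂.rank < m₂) (h₁ : H₁.rank < n₁) :
    cssDistX (HX H₁ H₂) (HZ H₁ H₂) = min (minDist (pcCode H₁ᵀ)) (minDist (pcCode H₂)) := by
  rw [dX_eq, iInf_pos ((pcCode_transpose_ne_bot_iff_rank_lt H₂).2 h₂), iInf_pos ((pcCode_ne_bot_iff_rank_lt H₁).2 h₁)]

/-- **`Z`-distance with the second seed of full row rank** (`rank H₂ = m₂`, i.e. `k₂ᵀ = 0`, and `rank H₂ < n₂`,
`rank H₁ < m₁`): still `d_Z = min(d₁, d₂ᵀ) = d₁` since `d₂ᵀ = ⊤` — recorded for contrast with `dX_eq_of_rank_right`,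
where the full-rank seed DELETES a term. [cite: ZengPryadko2020, Thm 17 (chunk p0018 L1-12)] -/
theorem dZ_eq_of_rank_right (H₁ : Matrix (Fin m₁) (Fin n₁) (ZMod 2)) (H₂ : Matrix (Fin m₂) (Fin n₂) (ZMod 2))
    (hr₂ : H₂.rank = m₂) (h₂ : H₂.rank < n₂) (h₁ : H₁.rank < m₁) :
    cssDistZ (HX H₁ H₂) (HZ H₁ H₂) = minDist (pcCode H₁) := by
  rw [dZ_eq_of_rank_lt H₁ H₂ h₂ h₁, pcCode_transpose_eq_bot_of_rank H₂ hr₂, Literature.InformationTheory.Coding.minDist_bot,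
    min_top_right]

/-- **`X`-distance with the second seed of full row rank** (`rank H₂ = m₂`) and `rank H₁ < n₁`: `d_X = d₂` — the
term `d₁ᵀ` is absent (guard `[k₂ᵀ ≥ 1]` fails) even when `d₁ᵀ < d₂`; this is the case Tillich–Zémor's bound leaves open.
[cite: ZengPryadko2020, Thm 17 (chunk p0018 L1-12)] -/
theorem dX_eq_of_rank_right (H₁ : Matrix (Fin m₁) (Fin n₁) (ZMod 2)) (H₂ : Matrix (Fin m₂) (Fin n₂) (ZMod 2))
    (hr₂ : H₂.rank = m₂) (h₁ : H₁.rank < n₁) :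
    cssDistX (HX H₁ H₂) (HZ H₁ H₂) = minDist (pcCode H₂) := by
  have hg : ¬ (pcCode H₂ᵀ ≠ ⊥) := fun h => h (pcCode_transpose_eq_bot_of_rank H₂ hr₂)
  rw [dX_eq, iInf_neg hg, iInf_pos ((pcCode_ne_bot_iff_rank_lt H₁).2 h₁), min_top_left]

end Summit.Ventures.QEC.HGP
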